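import Summits.Ventures.CertifiedQuantumChemistry.Rows.HoleTransferTable
import HarnessLib

/-!
# Ventures/CertifiedQuantumChemistry — Rows/HoleTransferRows.lean: the operator identity
# `Ĥ(K) = μ·Ĥ(F) + t·G_c − X_c` of the HOLE-TRANSFER TABLE FILE `K = Model.transferHole c μ t F` and the
# END-TO-END `dE-direct:s` row `LowerRow K (source) + UpperRow F (source) ⇒ DiffUpperRow F (target) F (source) t`

HONEST FRAMING (verbatim): certified bounds for a stated model Hamiltonian in a stated basis; not a
claim about the real molecule or material beyond that model. `K` is NOT a physical Hamiltonian; it is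
DATA for one SDP leg.

Typer chem-type-09 (LADDER-CHEM I-TYPE slot 09 class (s), item (L2) of chem-solver-5's
`solver/diff-sector/DESIGN.md` §4.1/§6; sequel of `Rows/HoleTransferTable.lean`, which defines the
tables `Model.holeTable` / `Model.transferHole` and the operators `holeOp`, `holeGram`,
`holeCommutatorOp` with `holeGram_eq`, `holeCommutatorOp_eq`).

## Contents (all PROVED; two auxiliary operator `def`s)
* §3 `half_sum_holeTwoBody_smul`
  (the symmetrised two-body table realises the HERMITIAN PART `½(Σ A e + (Σ A e)ᴴ)` — adjoint
  `e_pqrs† = e_qpsr` + pair symmetry, no symmetry of the table needed), `sum_holeTable_h_smul`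
  (one-body part `t·G_c + ½(O₁ + O₁ᴴ)`), `holeCommutatorOp_eq_add` (`O = O₁ + O₂`), and
  **`Model.hamiltonian_holeTable`**: for pair-symmetric `g` (`g_pqrs = g_rspq`, part of
  `Model.IsEightfold`), `Ĥ(holeTable c t F) = t·G_c + ½(O + Oᴴ)`; hence
  **`Model.hamiltonian_transferHole`**: `Ĥ(K) = μ·Ĥ(F) + t·G_c − X_c`, `X_c := −½(O + Oᴴ)` — the
  hypothesis `hK` of `Rows/SectorTransferRows.diffUpperRow_of_transfer_window`.
* §4 `holeTransfer_hypothesis` — the `(G, X)` transfer hypothesis of that theorem for the spin-summed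
  hole (both spin legs via `transfer_inequality`; the target energy must lie below both one-hole
  sectors' energies) — and the END-TO-END rows: `diffUpperRow_of_transferHole` (general sector
  bookkeeping), `diffUpperRow_of_transferHole_up` (source `(a + 1, b)` with `b ≤ a + 1`, target `(a, b)`:
  the model's vertical IP `E₀(a, b) − E₀(a + 1, b) ≤ t`), `diffUpperRow_of_transferHole_closedShell`
  (source `(m + 1, m + 1)`, both one-hole targets at once; EL.A(i) «ox» `(12,12) → (12,11)`).

What is NOT here: the particle and spin-flip classes; any certificate instance, number or claim node.
Printed neighbours (ESTIMATORS in print, never certificates): extended Koopmans theorem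
(Morrell–Parr–Levy, J. Chem. Phys. 62 (1975) 549; Smith–Day, J. Chem. Phys. 62 (1975) 113); the
operator identity is HJO §10.8.3 eq. (10.8.20) via the tree's
`sum_creation_mul_commutator_annihilation_hamiltonian`. [cite: HelgakerJorgensenOlsen2000, eq. (10.8.20)]
-/

noncomputable section

namespace Summit.Ventures.CertifiedQuantumChemistry

open Matrix Finset
open Literature.MathematicalPhysics.QuantumLattice Literature.MathematicalPhysics.QuantumChemistry
open Literature.MathematicalPhysics.QuantumLattice.EigenvalueContinuation
open scoped ComplexOrder

variable {k : ℕ}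

/-- A rational cast to `ℂ` is self-adjoint. [folklore] -/
private theorem star_ratCast' (x : ℚ) : star ((x : ℚ) : ℂ) = ((x : ℚ) : ℂ) := by
  rw [Complex.star_def, map_ratCast]

/-! ## §3 The operator identity `Ĥ(holeTable) = t·G_c + ½(O + Oᴴ)` -/

/-- Reindexing a quadruple sum: `(p,q,r,s) ↦ (q,p,s,r)` (adjoint pattern). [folklore] -/
private theorem sum4_reindex_adj (f : Fin k → Fin k → Fin k → Fin k → ℂ)
    (e : Fin k → Fin k → Fin k → Fin k → Op k) :
    ∑ p : Fin k, ∑ q : Fin k, ∑ r : Fin k, ∑ s : Fin k, f q p s r • e p q r s =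
      ∑ p : Fin k, ∑ q : Fin k, ∑ r : Fin k, ∑ s : Fin k, f p q r s • e q p s r := by
  rw [Finset.sum_comm]
  refine Finset.sum_congr rfl fun a _ => Finset.sum_congr rfl fun b _ => ?_
  rw [Finset.sum_comm]

/-- Reindexing a quadruple sum: `(p,q,r,s) ↦ (r,s,p,q)` (pair-swap pattern). [folklore] -/
private theorem sum4_reindex_pair (f : Fin k → Fin k → Fin k → Fin k → ℂ)
    (e : Fin k → Fin k → Fin k → Fin k → Op k) :
    ∑ p : Fin k, ∑ q : Fin k, ∑ r : Fin k, ∑ s : Fin k, f r s p q • e p q r s =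
      ∑ p : Fin k, ∑ q : Fin k, ∑ r : Fin k, ∑ s : Fin k, f p q r s • e r s p q := by
  -- move the `(r, s)` sums outside the `(p, q)` sums on the left
  have step1 : ∀ p : Fin k, ∑ q : Fin k, ∑ r : Fin k, ∑ s : Fin k, f r s p q • e p q r s =
      ∑ r : Fin k, ∑ q : Fin k, ∑ s : Fin k, f r s p q • e p q r s := fun p => Finset.sum_comm
  simp_rw [step1]
  rw [Finset.sum_comm]
  refine Finset.sum_congr rfl fun r _ => ?_
  have step2 : ∀ p : Fin k, ∑ q : Fin k, ∑ s : Fin k, f r s p q • e p q r s =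
      ∑ s : Fin k, ∑ q : Fin k, f r s p q • e p q r s := fun p => Finset.sum_comm
  simp_rw [step2]
  rw [Finset.sum_comm]

/-- Adjoint of a real combination of two-electron excitation operators:
`(Σ A_pqrs e_pqrs)ᴴ = Σ A_pqrs e_qpsr`. [folklore] -/
private theorem conjTranspose_sum4_twoElectron (A : Fin k → Fin k → Fin k → Fin k → ℚ) :
    (∑ p : Fin k, ∑ q : Fin k, ∑ r : Fin k, ∑ s : Fin k,
        ((A p q r s : ℚ) : ℂ) • (twoElectronExcitation p q r s : Op k))ᴴ =
      ∑ p : Fin k, ∑ q : Fin k, ∑ r : Fin k, ∑ s : Fin k,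
        ((A p q r s : ℚ) : ℂ) • (twoElectronExcitation q p s r : Op k) := by
  simp only [conjTranspose_sum, conjTranspose_smul, conjTranspose_twoElectronExcitation, star_ratCast']

/-- Adjoint of a real combination of singlet excitation operators: `(Σ B_pq E_pq)ᴴ = Σ B_pq E_qp`.
[folklore] -/
private theorem conjTranspose_sum2_singlet (B : Fin k → Fin k → ℚ) :
    (∑ p : Fin k, ∑ q : Fin k, ((B p q : ℚ) : ℂ) • (singletExcitation p q : Op k))ᴴ =
      ∑ p : Fin k, ∑ q : Fin k, ((B p q : ℚ) : ℂ) • (singletExcitation q p : Op k) := by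
  simp only [conjTranspose_sum, conjTranspose_smul, conjTranspose_singletExcitation, star_ratCast']

/-- **The symmetrised two-body table realises the Hermitian part**: for any rational `A`,
`½ Σ (A_pqrs + A_qpsr + A_rspq + A_srqp)/2 • e_pqrs = ½ (Σ A e + (Σ A e)ᴴ)` — adjoint
`e_pqrs† = e_qpsr` and pair symmetry `e_pqrs = e_rspq`; no symmetry of `A` is used. [folklore] -/
theorem half_sum_holeTwoBody_smul (c : Fin k → ℚ) (F : Model k) :
    (1 / 2 : ℂ) • ∑ p : Fin k, ∑ q : Fin k, ∑ r : Fin k, ∑ s : Fin k,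
        ((Model.holeTwoBody c F p q r s : ℚ) : ℂ) • (twoElectronExcitation p q r s : Op k) =
      (1 / 2 : ℂ) • (∑ p : Fin k, ∑ q : Fin k, ∑ r : Fin k, ∑ s : Fin k,
          ((Model.holeTwoBodyRaw c F p q r s : ℚ) : ℂ) • (twoElectronExcitation p q r s : Op k) +
        (∑ p : Fin k, ∑ q : Fin k, ∑ r : Fin k, ∑ s : Fin k,
          ((Model.holeTwoBodyRaw c F p q r s : ℚ) : ℂ) • (twoElectronExcitation p q r s : Op k))ᴴ) := by
  set A : Fin k → Fin k → Fin k → Fin k → ℂ := fun p q r s => ((Model.holeTwoBodyRaw c F p q r s : ℚ) : ℂ)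
    with hA
  -- the four pieces of `holeTwoBody`
  have hsplit : ∀ p q r s : Fin k, ((Model.holeTwoBody c F p q r s : ℚ) : ℂ) =
      (1 / 2 : ℂ) * (A p q r s + A q p s r + A r s p q + A s r q p) := by
    intro p q r s
    simp only [hA, Model.holeTwoBody]
    push_cast
    ring
  have h2 : ∑ p : Fin k, ∑ q : Fin k, ∑ r : Fin k, ∑ s : Fin k,
      A q p s r • (twoElectronExcitation p q r s : Op k) =
      (∑ p : Fin k, ∑ q : Fin k, ∑ r : Fin k, ∑ s : Fin k,
        A p q r s • (twoElectronExcitation p q r s : Op k))ᴴ := by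
    rw [sum4_reindex_adj A fun p q r s => (twoElectronExcitation p q r s : Op k), hA,
      conjTranspose_sum4_twoElectron]
  have h3 : ∑ p : Fin k, ∑ q : Fin k, ∑ r : Fin k, ∑ s : Fin k,
      A r s p q • (twoElectronExcitation p q r s : Op k) =
      ∑ p : Fin k, ∑ q : Fin k, ∑ r : Fin k, ∑ s : Fin k,
        A p q r s • (twoElectronExcitation p q r s : Op k) := by
    rw [sum4_reindex_pair A fun p q r s => (twoElectronExcitation p q r s : Op k)]
    simp_rw [← twoElectronExcitation_pairSwap]
  have h4 : ∑ p : Fin k, ∑ q : Fin k, ∑ r : Fin k, ∑ s : Fin k,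
      A s r q p • (twoElectronExcitation p q r s : Op k) =
      (∑ p : Fin k, ∑ q : Fin k, ∑ r : Fin k, ∑ s : Fin k,
        A p q r s • (twoElectronExcitation p q r s : Op k))ᴴ := by
    rw [sum4_reindex_pair (fun p q r s => A q p s r) fun p q r s => (twoElectronExcitation p q r s : Op k)]
    simp_rw [← twoElectronExcitation_pairSwap]
    exact h2
  simp_rw [hsplit, mul_add, add_smul, Finset.sum_add_distrib, ← smul_smul, ← Finset.smul_sum]
  rw [h2, h3, h4, hA]
  module

/-- The one-body operator `O₁ = Σ_pq c_p (ch)_q E_pq` (one-body part of `O`). -/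
def holeOneBodyOp (c : Fin k → ℚ) (F : Model k) : Op k :=
  ∑ p : Fin k, ∑ q : Fin k, ((c p * Model.holeVecH c F q : ℚ) : ℂ) • singletExcitation p q

/-- The two-body operator `O₂ = Σ_pqrs A_pqrs e_pqrs` (two-body part of `O`). -/
def holeTwoBodyOp (c : Fin k → ℚ) (F : Model k) : Op k :=
  ∑ p : Fin k, ∑ q : Fin k, ∑ r : Fin k, ∑ s : Fin k,
    ((Model.holeTwoBodyRaw c F p q r s : ℚ) : ℂ) • twoElectronExcitation p q r s

/-- **The one-body table realises `t·G_c + ½(O₁ + O₁ᴴ)`**: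
`Σ_pq (t c_p c_q + ½(c_p (ch)_q + c_q (ch)_p)) E_pq = t·G_c + ½(O₁ + O₁ᴴ)` (`E_pq† = E_qp`). [folklore] -/
theorem sum_holeTable_h_smul (c : Fin k → ℚ) (t : ℚ) (F : Model k) :
    ∑ p : Fin k, ∑ q : Fin k, (((Model.holeTable c t F).h p q : ℚ) : ℂ) • (singletExcitation p q : Op k) =
      ((t : ℚ) : ℂ) • holeGram c + (1 / 2 : ℂ) • (holeOneBodyOp c F + (holeOneBodyOp c F)ᴴ) := by
  have hsplit : ∀ p q : Fin k, (((Model.holeTable c t F).h p q : ℚ) : ℂ) =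
      ((t : ℚ) : ℂ) * ((c p * c q : ℚ) : ℂ) +
        ((1 / 2 : ℂ) * ((c p * Model.holeVecH c F q : ℚ) : ℂ) +
          (1 / 2 : ℂ) * ((c q * Model.holeVecH c F p : ℚ) : ℂ)) := by
    intro p q
    simp only [Model.holeTable]
    push_cast
    ring
  have hswap : ∑ p : Fin k, ∑ q : Fin k,
      ((c q * Model.holeVecH c F p : ℚ) : ℂ) • (singletExcitation p q : Op k) =
      (holeOneBodyOp c F)ᴴ := by
    rw [holeOneBodyOp, conjTranspose_sum2_singlet, Finset.sum_comm]
  simp_rw [hsplit, add_smul, Finset.sum_add_distrib, ← smul_smul, ← Finset.smul_sum]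
  rw [hswap, ← holeGram_eq, holeOneBodyOp, smul_add]

/-- **`O = O₁ + O₂`** (regrouping HJO (10.8.20): `Σ_mn c_m c_n Σ_q h_nq E_mq = Σ_mq c_m (ch)_q E_mq` and
`Σ_mn c_m c_n Σ_qrs g_nqrs e_mqrs = Σ_mqrs A_mqrs e_mqrs`); needs the pair symmetry `g_pqrs = g_rspq`.
[cite: HelgakerJorgensenOlsen2000, eq. (10.8.20)] -/
theorem holeCommutatorOp_eq_add (c : Fin k → ℚ) {F : Model k}
    (hg : ∀ p q r s, F.eri p q r s = F.eri r s p q) :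
    holeCommutatorOp c F = holeOneBodyOp c F + holeTwoBodyOp c F := by
  rw [holeCommutatorOp_eq c hg]
  simp_rw [smul_add, Finset.sum_add_distrib]
  congr 1
  · -- one-body regrouping
    rw [holeOneBodyOp]
    refine Finset.sum_congr rfl fun m _ => ?_
    simp_rw [Finset.smul_sum, smul_smul]
    rw [Finset.sum_comm]
    refine Finset.sum_congr rfl fun q _ => ?_
    rw [← Finset.sum_smul]
    congr 1
    rw [Model.holeVecH]
    push_cast
    rw [Finset.mul_sum]
    refine Finset.sum_congr rfl fun n _ => ?_
    ring
  · -- two-body regrouping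
    rw [holeTwoBodyOp]
    refine Finset.sum_congr rfl fun m _ => ?_
    simp_rw [Finset.smul_sum, smul_smul]
    rw [Finset.sum_comm]
    refine Finset.sum_congr rfl fun q _ => ?_
    rw [Finset.sum_comm]
    refine Finset.sum_congr rfl fun r _ => ?_
    rw [Finset.sum_comm]
    refine Finset.sum_congr rfl fun s _ => ?_
    rw [← Finset.sum_smul]
    congr 1
    rw [Model.holeTwoBodyRaw]
    push_cast
    rw [Finset.mul_sum]
    refine Finset.sum_congr rfl fun n _ => ?_
    ring

/-- **THE OPERATOR OF THE HOLE TABLE**: for a model with pair-symmetric two-electron table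
(`g_pqrs = g_rspq`, part of the FCIDUMP 8-fold rule `Model.IsEightfold`),
`Ĥ(holeTable c t F) = t·G_c + ½(O + Oᴴ)` with `G_c = Σ_σ a†_{cσ}a_{cσ}` and
`O = Σ_σ a†_{cσ}(a_{cσ}Ĥ(F) − Ĥ(F)a_{cσ})` — the second-quantised reading of chem-solver-5's table
(DESIGN §4.1 «Herm Σ_σ a†_{cσ}[H, a_{cσ}] … Hermitised with E_pq† = E_qp, e_pqrs† = e_qpsr and
pair-symmetrised with e_pqrs = e_rspq»). [cite: HelgakerJorgensenOlsen2000, eq. (10.8.20)] -/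
theorem Model.hamiltonian_holeTable (c : Fin k → ℚ) (t : ℚ) {F : Model k}
    (hg : ∀ p q r s, F.eri p q r s = F.eri r s p q) :
    (Model.holeTable c t F).hamiltonian =
      ((t : ℚ) : ℂ) • holeGram c + (1 / 2 : ℂ) • (holeCommutatorOp c F + (holeCommutatorOp c F)ᴴ) := by
  have hH : (Model.holeTable c t F).hamiltonian =
      ∑ p : Fin k, ∑ q : Fin k, (((Model.holeTable c t F).h p q : ℚ) : ℂ) • singletExcitation p q +
        (1 / 2 : ℂ) • ∑ p : Fin k, ∑ q : Fin k, ∑ r : Fin k, ∑ s : Fin k,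
          ((Model.holeTwoBody c F p q r s : ℚ) : ℂ) • twoElectronExcitation p q r s +
        (((0 : ℚ) : ℚ) : ℂ) • (1 : Op k) := rfl
  rw [hH, Rat.cast_zero, zero_smul, add_zero, sum_holeTable_h_smul, half_sum_holeTwoBody_smul,
    holeCommutatorOp_eq_add c hg, conjTranspose_add]
  rw [show holeTwoBodyOp c F = ∑ p : Fin k, ∑ q : Fin k, ∑ r : Fin k, ∑ s : Fin k,
      ((Model.holeTwoBodyRaw c F p q r s : ℚ) : ℂ) • twoElectronExcitation p q r s from rfl]
  module

/-- **THE OPERATOR OF THE HOLE-TRANSFER FILE `K`** — the hypothesis `hK` of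
`Rows/SectorTransferRows.diffUpperRow_of_transfer_window`: for pair-symmetric `g`,
`Ĥ(transferHole c μ t F) = μ·Ĥ(F) + t·G_c − X_c` with `X_c := −½(O + Oᴴ)`.
[cite: HelgakerJorgensenOlsen2000, eq. (10.8.20)] -/
theorem Model.hamiltonian_transferHole (c : Fin k → ℚ) (μ t : ℚ) {F : Model k}
    (hg : ∀ p q r s, F.eri p q r s = F.eri r s p q) :
    (Model.transferHole c μ t F).hamiltonian =
      ((μ : ℚ) : ℂ) • F.hamiltonian + ((t : ℚ) : ℂ) • holeGram c -
        (-((1 / 2 : ℂ) • (holeCommutatorOp c F + (holeCommutatorOp c F)ᴴ))) := by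
  rw [Model.transferHole, Model.hamiltonian_lincomb, Model.hamiltonian_holeTable c t hg, Rat.cast_one,
    one_smul, sub_neg_eq_add, add_assoc]

/-! ## §4 The transfer hypothesis for the spin-summed hole and the end-to-end difference rows -/

/-- `Re⟨v, Oᴴ v⟩ = Re⟨v, O v⟩` (the form of the adjoint is the conjugate form). [folklore] -/
private theorem re_form_conjTranspose (O : Op k) (v : Fock (Orb (Fin k))) :
    (star v ⬝ᵥ Oᴴ *ᵥ v).re = (star v ⬝ᵥ O *ᵥ v).re := by
  rw [mulVec_conjTranspose, star_dotProduct_star, dotProduct_mulVec, Complex.star_def, Complex.conj_re]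

/-- `Re⟨v, −½(O + Oᴴ) v⟩ = −Re⟨v, O v⟩`. [folklore] -/
private theorem re_form_neg_half_herm (O : Op k) (v : Fock (Orb (Fin k))) :
    (star v ⬝ᵥ (-((1 / 2 : ℂ) • (O + Oᴴ))) *ᵥ v).re = -(star v ⬝ᵥ O *ᵥ v).re := by
  rw [neg_mulVec, dotProduct_neg, Complex.neg_re, smul_mulVec, dotProduct_smul, add_mulVec,
    dotProduct_add, smul_eq_mul, Complex.mul_re, Complex.add_re, Complex.add_im,
    re_form_conjTranspose]
  norm_num
  ring

/-- `⟨v, A†B v⟩ = ⟨Av, Bv⟩`. [folklore] -/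
private theorem form_conjTranspose_mul (A B : Op k) (v : Fock (Orb (Fin k))) :
    star v ⬝ᵥ (Aᴴ * B) *ᵥ v = star (A *ᵥ v) ⬝ᵥ (B *ᵥ v) := by
  rw [← mulVec_mulVec, dotProduct_mulVec, star_mulVec]

/-- **THE TRANSFER HYPOTHESIS FOR THE SPIN-SUMMED HOLE** (DESIGN §2.1 (T-h), both spin legs): for a
symmetric model `F`, an orbital vector `c`, a source sector `(a, b)`, sectors `(a₁, b₁) ∋ a_{c↑}ψ` and
`(a₂, b₂) ∋ a_{c↓}ψ`, and a target `(a′, b′)` whose energy is `≤` both of theirs: at every source-sector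
ground eigenvector `ψ`, `(E₀(a′, b′) − E₀(a, b))·Re⟨ψ, G_cψ⟩ ≤ Re⟨ψ, X_cψ⟩` with
`X_c = −½(O + Oᴴ)` and `Re⟨ψ, G_cψ⟩ = Σ_σ‖a_{cσ}ψ‖² ≥ 0` — two applications of `transfer_inequality`
(`Rows/SectorTransferRows.lean`). In print the `c`-optimised form is the extended Koopmans IP
(Morrell–Parr–Levy 1975; Smith–Day 1975; an estimator there, a certificate here).
[cite: HelgakerJorgensenOlsen2000, eq. (10.8.20)] -/
theorem holeTransfer_hypothesis {F : Model k} (hF : F.IsSymmetric) (c : Fin k → ℚ)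
    {a b a' b' a₁ b₁ a₂ b₂ : ℕ}
    (hup : ∀ v : Fock (Orb (Fin k)), IsInSector a b v → IsInSector a₁ b₁ (holeOp c 0 *ᵥ v))
    (hdown : ∀ v : Fock (Orb (Fin k)), IsInSector a b v → IsInSector a₂ b₂ (holeOp c 1 *ᵥ v))
    (h₁ : F.energy a' b' ≤ F.energy a₁ b₁) (h₂ : F.energy a' b' ≤ F.energy a₂ b₂) :
    ∀ ψ : Fock (Orb (Fin k)), IsInSector a b ψ → star ψ ⬝ᵥ ψ = 1 →
      F.hamiltonian *ᵥ ψ = ((F.energy a b : ℝ) : ℂ) • ψ →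
        (F.energy a' b' - F.energy a b) * (star ψ ⬝ᵥ holeGram c *ᵥ ψ).re ≤
            (star ψ ⬝ᵥ (-((1 / 2 : ℂ) •
              (holeCommutatorOp c F + (holeCommutatorOp c F)ᴴ))) *ᵥ ψ).re ∧
          0 ≤ (star ψ ⬝ᵥ holeGram c *ᵥ ψ).re := by
  intro ψ hψ _ hHψ
  -- the two legs of `transfer_inequality`
  have T0 := transfer_inequality hF (holeOp c 0) hup hψ hHψ
  have T1 := transfer_inequality hF (holeOp c 1) hdown hψ hHψ
  -- the Gram form is `‖a_{c↑}ψ‖² + ‖a_{c↓}ψ‖²`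
  have hG : (star ψ ⬝ᵥ holeGram c *ᵥ ψ).re =
      (star (holeOp c 0 *ᵥ ψ) ⬝ᵥ (holeOp c 0 *ᵥ ψ)).re +
        (star (holeOp c 1 *ᵥ ψ) ⬝ᵥ (holeOp c 1 *ᵥ ψ)).re := by
    rw [holeGram, Fin.sum_univ_two, add_mulVec, dotProduct_add, Complex.add_re,
      form_conjTranspose_mul, form_conjTranspose_mul]
  -- the `X` form is minus the sum of the two commutator forms
  have hX : (star ψ ⬝ᵥ (-((1 / 2 : ℂ) •
      (holeCommutatorOp c F + (holeCommutatorOp c F)ᴴ))) *ᵥ ψ).re =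
      (star ψ ⬝ᵥ ((holeOp c 0)ᴴ * (F.hamiltonian * holeOp c 0 - holeOp c 0 * F.hamiltonian)) *ᵥ ψ).re +
        (star ψ ⬝ᵥ ((holeOp c 1)ᴴ * (F.hamiltonian * holeOp c 1 - holeOp c 1 * F.hamiltonian)) *ᵥ ψ).re := by
    rw [re_form_neg_half_herm, holeCommutatorOp, Fin.sum_univ_two, add_mulVec, dotProduct_add,
      Complex.add_re]
    have e : ∀ σ : Fin 2, (holeOp c σ)ᴴ * (holeOp c σ * F.hamiltonian - F.hamiltonian * holeOp c σ) =
        -((holeOp c σ)ᴴ * (F.hamiltonian * holeOp c σ - holeOp c σ * F.hamiltonian)) := fun σ => by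
      rw [← Matrix.mul_neg, neg_sub]
    rw [e 0, e 1, neg_mulVec, neg_mulVec, dotProduct_neg, dotProduct_neg, Complex.neg_re, Complex.neg_re]
    ring
  have hn0 : 0 ≤ (star (holeOp c 0 *ᵥ ψ) ⬝ᵥ (holeOp c 0 *ᵥ ψ)).re := re_star_dotProduct_self_nonneg _
  have hn1 : 0 ≤ (star (holeOp c 1 *ᵥ ψ) ⬝ᵥ (holeOp c 1 *ᵥ ψ)).re := re_star_dotProduct_self_nonneg _
  have hm0 := mul_le_mul_of_nonneg_right (sub_le_sub_right h₁ (F.energy a b)) hn0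
  have hm1 := mul_le_mul_of_nonneg_right (sub_le_sub_right h₂ (F.energy a b)) hn1
  rw [hG, hX]
  constructor
  · rw [mul_add]
    linarith
  · linarith

/-- **END-TO-END `dE-direct:s` HOLE ROW.** For an 8-fold-symmetric model `F` (`Model.IsEightfold`,
`Rows/ModelPin.lean`), an orbital vector `c`, rationals `μ ≥ 0`, `t`, a source sector `(a, b)`,
one-hole sectors `(a₁, b₁) ∋ a_{c↑}ψ`, `(a₂, b₂) ∋ a_{c↓}ψ` and a target `(a′, b′)` in range with
energy below both: a certified LOWER row `ℓ ≤ E₀(K; a, b)` of the hole-transfer file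
`K = Model.transferHole c μ t F` (ONE FORMAT-qcl1 certificate on the exact table written by
`fcidump_transfer.py --class hole`), a certified UPPER row `E₀(F; a, b) ≤ u` and the strict margin
`μ·u < ℓ` prove `DiffUpperRow F a′ b′ F a b t`, i.e. `E₀(F; a′, b′) − E₀(F; a, b) ≤ t`
(`diffUpperRow_of_transfer_window` with `hK := Model.hamiltonian_transferHole` and
`htransfer := holeTransfer_hypothesis`). chem-solver-5 DESIGN §3 «L(K; s) − μ·U_s > 0 ⟹
min(E₀(a−1,b), E₀(a,b−1)) − E₀(a,b) < t». [cite: HelgakerJorgensenOlsen2000, eq. (10.8.20)] -/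
theorem diffUpperRow_of_transferHole {F : Model k} (hF : F.IsEightfold) (c : Fin k → ℚ)
    {μ t ℓ u : ℚ} {a b a' b' a₁ b₁ a₂ b₂ : ℕ} (ha' : a' ≤ k) (hb' : b' ≤ k)
    (hup : ∀ v : Fock (Orb (Fin k)), IsInSector a b v → IsInSector a₁ b₁ (holeOp c 0 *ᵥ v))
    (hdown : ∀ v : Fock (Orb (Fin k)), IsInSector a b v → IsInSector a₂ b₂ (holeOp c 1 *ᵥ v))
    (h₁ : F.energy a' b' ≤ F.energy a₁ b₁) (h₂ : F.energy a' b' ≤ F.energy a₂ b₂)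
    (hL : LowerRow (Model.transferHole c μ t F) a b ℓ) (hU : UpperRow F a b u) (hμ : 0 ≤ μ)
    (hmargin : μ * u < ℓ) : DiffUpperRow F a' b' F a b t :=
  diffUpperRow_of_transfer_window hF.isSymmetric (Model.transferHole_isSymmetric hF.isSymmetric c μ t)
    ha' hb' (holeGram c) (-((1 / 2 : ℂ) • (holeCommutatorOp c F + (holeCommutatorOp c F)ᴴ)))
    (Model.hamiltonian_transferHole c μ t hF.2.2.2)
    (holeTransfer_hypothesis hF.isSymmetric c hup hdown h₁ h₂) hL hU hμ hmargin

/-- The up-spin hole maps `(a + 1, b)` into `(a, b)` (`transferHole_isInSector_up`). [folklore] -/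
theorem holeOp_up_isInSector {a b : ℕ} (c : Fin k → ℚ) {v : Fock (Orb (Fin k))}
    (hv : IsInSector (a + 1) b v) : IsInSector a b (holeOp c 0 *ᵥ v) :=
  transferHole_isInSector_up (fun q => ((c q : ℚ) : ℂ)) hv

/-- The down-spin hole maps `(a, b + 1)` into `(a, b)` (`transferHole_isInSector_down`). [folklore] -/
theorem holeOp_down_isInSector {a b : ℕ} (c : Fin k → ℚ) {v : Fock (Orb (Fin k))}
    (hv : IsInSector a (b + 1) v) : IsInSector a b (holeOp c 1 *ᵥ v) :=
  transferHole_isInSector_down (fun q => ((c q : ℚ) : ℂ)) hv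

/-- The down-spin hole kills a sector without down electrons. [folklore] -/
theorem holeOp_down_mulVec_eq_zero {a : ℕ} (c : Fin k → ℚ) {v : Fock (Orb (Fin k))}
    (hv : IsInSector a 0 v) : holeOp c 1 *ᵥ v = 0 := by
  rw [holeOp, Matrix.sum_mulVec]
  exact Finset.sum_eq_zero fun q _ => by rw [smul_mulVec, hv.annihilation_down_mulVec_eq_zero q, smul_zero]

/-- The zero vector lies in every sector. [folklore] -/
private theorem isInSector_zero (a b : ℕ) : IsInSector a b (0 : Fock (Orb (Fin k))) := fun _ _ => rfl

/-- **VERTICAL IP ROW (source `N_α ≥ N_β`, remove an up electron).** For an 8-fold-symmetric `F`,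
source sector `(a + 1, b)` with `b ≤ a + 1`, target `(a, b)` (the LOWER of the two one-hole sectors,
`Model.energy_le_energy_of_max_le`): `LowerRow (Model.transferHole c μ t F) (a + 1) b ℓ`,
`UpperRow F (a + 1) b u`, `0 ≤ μ`, `μ·u < ℓ` ⇒ `DiffUpperRow F a b F (a + 1) b t` — the model's
vertical ionisation energy `E₀(a, b) − E₀(a + 1, b)` is at most `t`.
[cite: HelgakerJorgensenOlsen2000, eq. (10.8.20)] -/
theorem diffUpperRow_of_transferHole_up {F : Model k} (hF : F.IsEightfold) (c : Fin k → ℚ)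
    {μ t ℓ u : ℚ} {a b : ℕ} (hba : b ≤ a + 1)
    (hL : LowerRow (Model.transferHole c μ t F) (a + 1) b ℓ) (hU : UpperRow F (a + 1) b u)
    (hμ : 0 ≤ μ) (hmargin : μ * u < ℓ) : DiffUpperRow F a b F (a + 1) b t := by
  obtain ⟨ha1, hb⟩ := hU.range
  have ha : a ≤ k := (Nat.le_succ a).trans ha1
  cases b with
  | zero =>
    exact diffUpperRow_of_transferHole hF c ha hb (fun v hv => holeOp_up_isInSector c hv)
      (fun v hv => by rw [holeOp_down_mulVec_eq_zero c hv]; exact isInSector_zero a 0)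
      le_rfl le_rfl hL hU hμ hmargin
  | succ b₀ =>
    have hb₀ : b₀ ≤ k := (Nat.le_succ b₀).trans hb
    have hle : F.energy a (b₀ + 1) ≤ F.energy (a + 1) b₀ :=
      Model.energy_le_energy_of_max_le hF.isSymmetric ha1 hb₀ (by omega)
        (max_le (by omega) (by omega))
    exact diffUpperRow_of_transferHole hF c ha hb (fun v hv => holeOp_up_isInSector c hv)
      (fun v hv => holeOp_down_isInSector c hv) le_rfl hle hL hU hμ hmargin

/-- **CLOSED-SHELL-TYPE SOURCE `(m + 1, m + 1)`: both one-hole rows at once** (EL.A(i) «ox»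
`(12,12) → (12,11)` and its mirror `(11,12)`, equal energies by `Model.energy_symm`): the hole-transfer
certificate bounds `E₀(m, m + 1) − E₀(m + 1, m + 1)` AND `E₀(m + 1, m) − E₀(m + 1, m + 1)` by `t`.
[cite: HelgakerJorgensenOlsen2000, eq. (10.8.20)] -/
theorem diffUpperRow_of_transferHole_closedShell {F : Model k} (hF : F.IsEightfold)
    (c : Fin k → ℚ) {μ t ℓ u : ℚ} {m : ℕ}
    (hL : LowerRow (Model.transferHole c μ t F) (m + 1) (m + 1) ℓ)
    (hU : UpperRow F (m + 1) (m + 1) u) (hμ : 0 ≤ μ) (hmargin : μ * u < ℓ) :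
    DiffUpperRow F m (m + 1) F (m + 1) (m + 1) t ∧ DiffUpperRow F (m + 1) m F (m + 1) (m + 1) t := by
  obtain ⟨hm1, -⟩ := hU.range
  have hm : m ≤ k := (Nat.le_succ m).trans hm1
  refine ⟨diffUpperRow_of_transferHole_up hF c le_rfl hL hU hμ hmargin, ?_⟩
  exact diffUpperRow_of_transferHole hF c hm1 hm (fun v hv => holeOp_up_isInSector c hv)
    (fun v hv => holeOp_down_isInSector c hv) (le_of_eq (Model.energy_symm F (m + 1) m)) le_rfl
    hL hU hμ hmargin

end Summit.Ventures.CertifiedQuantumChemistry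

end
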